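import Summits.QuantumFields.YangMills.Theorems.BalabanUVNodesSpineReadingOfRecord13CoPHK
import Summits.QuantumFields.YangMills.Theorems.BalabanUVNodesN19RekeyingCalculus

/-!
# THE KEY-READING DIAL COMPOSES — `crOfRecord₁₃K` along a composite dial is the re-keying of the reading at the first dial along the second (node U5d's partial
# summation is functorial), and the LEVEL WINDOWS form a TOWER: the floor-`max c c′` reading is the re-keying of the floor-`c` reading along `windowKeySigma c′`

Cell `pub-ymgap`, YM-PLAN Track A (HUMAN RULING D-0062; width push D-0149); seat `pub-ymgap-dag-n20-d` (R134 (a) N20 NE7b s3 = the U5d ∕ `crOfRecord₁₃` lineage) gen 29;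
companion of `Thm/BalabanUVNodesSpineReadingOfRecord13CoPHK` (p608328; the reading with a key-reading dial `crOfRecord₁₃KAt K₀ kr bd sh`, carriers `classSetK₁₃ ∕ weightAK₁₃ ∕
weightBK₁₃`) and of `Literature/…/Node00/TwoRunSiteWindow` (p608088; `windowKeySigma`, `windowKeySigma_windowKeySigma`).  `--kind proof --supports stmt-QuantumFields-20544 --as
helper`; THEOREMS ONLY (0 def); COUNT-NEUTRAL.  Consumes BY NAME dag-n19-w1's re-keying algebra `N19RekeyingCalculus.classVal_comp` (p593255 §1) and `Finset.image_image`.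

WHY.  dag-n19-w1's calculus moves the N19′ slot along class maps: `core_of_core_classVal` turns `Core` at a key `S, π` into `Core` at the IMAGE key with carriers
`classVal S π a` (descent free, p593255 §2); `core_of_core_classVal_comp` (p604222) stacks two maps.  Applied to the window road (crux card `window-key-core`), a proof that
produces `Core` at floor `c` and wants it at a COARSER floor `c′ ≥ c` lands — after their lemma — on the carriers `(classSetK₁₃ (window c)).image (window c′)`,
`classVal (classSetK₁₃ (window c)) (window c′) (weightAK₁₃ (window c))`; this file identifies those carriers with the floor-`max c c′` READING's own (`§2`), so the output is
literally a statement about `crOfRecord₁₃KAt K₀ (windowKeyReading₁₃ K₀ cmax) …` — the glue between their calculus and the record, nothing more.  §1 is the dial-generic form: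
for ANY two key readings, the composite-dial carriers are the re-keying of the first-dial carriers along the second.
HONEST FRAMING.  [folklore] finite-sum bookkeeping (functoriality of partial summation); NO estimate; `Core` ∕ `HybridNE7` transport itself stays dag-n19-w1's (not restated);
nothing of Bałaban's asserted; NE7 ∕ NE7b ∕ NE7c NOT PRINTED for d = 4 ∕ NOT proved; no stub of K3⁷ closed or claimed; N19 ∕ N20 ∕ N21 NOT discharged; counts UNMOVED (typed
28∕28 · discharged 5∕27); one finite four-torus programme at fixed `ε` — NOT ℝ⁴, NOT OS, NOT a mass gap, NOT the Clay problem.  No decl below carries a cite tag.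
-/

noncomputable section

open scoped BigOperators
open Finset

namespace YMDAG.UVSplit

open Literature.MathematicalPhysics.QuantumFieldTheory.Balaban1983to89
open Literature.MathematicalPhysics.QuantumFieldTheory.Balaban1983to89.T4Continuum
open Literature.MathematicalPhysics.QuantumFieldTheory.Balaban1983to89.Node00
open T4MatchingAssembly (classVal)
open Summit.QuantumFields.YangMills.BalabanUVNodes.N19RekeyingCalculus (classVal_comp)

variable {F : T4Family} {N : ℕ} [NeZero N]

/-! ## §1 Composite dials: the carriers along `kr₂ ∘ kr₁` are the re-keying of the `kr₁`-carriers along `kr₂` -/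

section Comp

variable (θ : Stage13HParams F N) (hP : θ.Provisos₁₃CoPH F N) (K₀ : ℕ) (g₀ : ℕ → ℝ) (os : List (ULoop F))
  (kr₁ kr₂ : ℕ → (Σ K, SiteSeqKey F (K₀ + K)) → (Σ K, SiteSeqKey F (K₀ + K)))

/-- ★ **THE COARSE CLASS SET OF A COMPOSITE DIAL** is the image of the first dial's coarse class set under the second. [bookkeeping] -/
theorem classSetK₁₃_comp (K : ℕ) :
    classSetK₁₃ θ K₀ g₀ (fun K x => kr₂ K (kr₁ K x)) K =
      letI : ∀ Kc, DecidableEq (SiteSeqKey F Kc) := fun _ => Classical.decEq _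
      (classSetK₁₃ θ K₀ g₀ kr₁ K).image (kr₂ K) := by
  letI : ∀ Kc, DecidableEq (SiteSeqKey F Kc) := fun _ => Classical.decEq _
  unfold classSetK₁₃
  rw [Finset.image_image]
  rfl

/-- ★ **RUN A's COARSE WEIGHT ALONG A COMPOSITE DIAL** is node U5d's partial sum of the first dial's coarse weight along the second (functoriality of `classVal`, dag-n19-w1's
`classVal_comp` with `hmaps := kr_mem_classSetK₁₃`). [bookkeeping] -/
theorem weightAK₁₃_comp (K : ℕ) (t : ℝ) (u : Σ K, SiteSeqKey F (K₀ + K)) :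
    weightAK₁₃ θ hP K₀ g₀ os (fun K x => kr₂ K (kr₁ K x)) K t u =
      letI : ∀ Kc, DecidableEq (SiteSeqKey F Kc) := fun _ => Classical.decEq _
      classVal (classSetK₁₃ θ K₀ g₀ kr₁) kr₂ (weightAK₁₃ θ hP K₀ g₀ os kr₁) K t u := by
  letI : ∀ Kc, DecidableEq (SiteSeqKey F Kc) := fun _ => Classical.decEq _
  exact (classVal_comp (S := classSet₁₃ θ K₀ g₀) (T := classSetK₁₃ θ K₀ g₀ kr₁) (π := kr₁) (a := weightA₁₃ θ hP K₀ g₀ os) kr₂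
    (fun K x hx => kr_mem_classSetK₁₃ θ K₀ g₀ kr₁ hx) K t u).symm

/-- ★ **RUN B's COARSE WEIGHT ALONG A COMPOSITE DIAL**, likewise. [bookkeeping] -/
theorem weightBK₁₃_comp (K : ℕ) (t : ℝ) (u : Σ K, SiteSeqKey F (K₀ + K)) :
    weightBK₁₃ θ hP K₀ g₀ os (fun K x => kr₂ K (kr₁ K x)) K t u =
      letI : ∀ Kc, DecidableEq (SiteSeqKey F Kc) := fun _ => Classical.decEq _
      classVal (classSetK₁₃ θ K₀ g₀ kr₁) kr₂ (weightBK₁₃ θ hP K₀ g₀ os kr₁) K t u := by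
  letI : ∀ Kc, DecidableEq (SiteSeqKey F Kc) := fun _ => Classical.decEq _
  exact (classVal_comp (S := classSet₁₃ θ K₀ g₀) (T := classSetK₁₃ θ K₀ g₀ kr₁) (π := kr₁) (a := weightB₁₃ θ hP K₀ g₀ os) kr₂
    (fun K x hx => kr_mem_classSetK₁₃ θ K₀ g₀ kr₁ hx) K t u).symm

/-- Every dial factors through the identity dial: the coarse carriers are the re-keying of the RECORD's carriers (`classSet₁₃ ∕ weightA₁₃`) along the dial — the form
dag-n19-w1's `core_of_core_classVal` produces from a `Core` at the pinned record. [bookkeeping] -/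
theorem weightAK₁₃_eq_classVal_record (kr : ℕ → (Σ K, SiteSeqKey F (K₀ + K)) → (Σ K, SiteSeqKey F (K₀ + K))) (K : ℕ) (t : ℝ) (u : Σ K, SiteSeqKey F (K₀ + K)) :
    weightAK₁₃ θ hP K₀ g₀ os kr K t u =
      letI : ∀ Kc, DecidableEq (SiteSeqKey F Kc) := fun _ => Classical.decEq _
      classVal (classSet₁₃ θ K₀ g₀) kr (weightA₁₃ θ hP K₀ g₀ os) K t u :=
  rfl

/-- Run B, likewise (`rfl`). [bookkeeping] -/
theorem weightBK₁₃_eq_classVal_record (kr : ℕ → (Σ K, SiteSeqKey F (K₀ + K)) → (Σ K, SiteSeqKey F (K₀ + K))) (K : ℕ) (t : ℝ) (u : Σ K, SiteSeqKey F (K₀ + K)) :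
    weightBK₁₃ θ hP K₀ g₀ os kr K t u =
      letI : ∀ Kc, DecidableEq (SiteSeqKey F Kc) := fun _ => Classical.decEq _
      classVal (classSet₁₃ θ K₀ g₀) kr (weightB₁₃ θ hP K₀ g₀ os) K t u :=
  rfl

end Comp

/-! ## §2 The tower of level windows: floor `max c c′` = floor `c` re-keyed along `windowKeySigma c′` -/

section Tower

variable (θ : Stage13HParams F N) (hP : θ.Provisos₁₃CoPH F N) (K₀ : ℕ) (g₀ : ℕ → ℝ) (os : List (ULoop F)) (c c' : ℕ → ℕ)

/-- Two window dials compose to the window dial with the floorwise HIGHER floor (`Node00.windowKeySigma_windowKeySigma`). [bookkeeping] -/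
theorem windowDial_comp :
    (fun (_ : ℕ) (x : Σ K, SiteSeqKey F (K₀ + K)) => windowKeySigma F c' (windowKeySigma F c x)) =
      fun (_ : ℕ) (x : Σ K, SiteSeqKey F (K₀ + K)) => windowKeySigma F (fun K => max (c K) (c' K)) x := by
  funext K x
  exact windowKeySigma_windowKeySigma F c c' x

/-- ★ **THE WINDOW CLASS SETS FORM A TOWER**: the floor-`max c c′` class set is the image of the floor-`c` class set under the floor-`c′` window. [bookkeeping] -/
theorem classSetK₁₃_window_max (K : ℕ) :
    classSetK₁₃ θ K₀ g₀ (fun _ x => windowKeySigma F (fun K => max (c K) (c' K)) x) K =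
      letI : ∀ Kc, DecidableEq (SiteSeqKey F Kc) := fun _ => Classical.decEq _
      (classSetK₁₃ θ K₀ g₀ (fun _ x => windowKeySigma F c x) K).image (windowKeySigma F c') := by
  rw [← windowDial_comp K₀ c c']
  exact classSetK₁₃_comp θ K₀ g₀ _ _ K

/-- ★ **RUN A's WINDOW WEIGHTS FORM A TOWER**: the floor-`max c c′` weight is the partial sum of the floor-`c` weight along the floor-`c′` window. [bookkeeping] -/
theorem weightAK₁₃_window_max (K : ℕ) (t : ℝ) (u : Σ K, SiteSeqKey F (K₀ + K)) :
    weightAK₁₃ θ hP K₀ g₀ os (fun _ x => windowKeySigma F (fun K => max (c K) (c' K)) x) K t u =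
      letI : ∀ Kc, DecidableEq (SiteSeqKey F Kc) := fun _ => Classical.decEq _
      classVal (classSetK₁₃ θ K₀ g₀ (fun _ x => windowKeySigma F c x)) (fun _ x => windowKeySigma F c' x)
        (weightAK₁₃ θ hP K₀ g₀ os (fun _ x => windowKeySigma F c x)) K t u := by
  rw [← windowDial_comp K₀ c c']
  exact weightAK₁₃_comp θ hP K₀ g₀ os _ _ K t u

/-- ★ **RUN B's WINDOW WEIGHTS FORM A TOWER**, likewise. [bookkeeping] -/
theorem weightBK₁₃_window_max (K : ℕ) (t : ℝ) (u : Σ K, SiteSeqKey F (K₀ + K)) :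
    weightBK₁₃ θ hP K₀ g₀ os (fun _ x => windowKeySigma F (fun K => max (c K) (c' K)) x) K t u =
      letI : ∀ Kc, DecidableEq (SiteSeqKey F Kc) := fun _ => Classical.decEq _
      classVal (classSetK₁₃ θ K₀ g₀ (fun _ x => windowKeySigma F c x)) (fun _ x => windowKeySigma F c' x)
        (weightBK₁₃ θ hP K₀ g₀ os (fun _ x => windowKeySigma F c x)) K t u := by
  rw [← windowDial_comp K₀ c c']
  exact weightBK₁₃_comp θ hP K₀ g₀ os _ _ K t u

/-- Raising the floor where it is already higher changes nothing: for `c ≤ c′` floorwise the floor-`c′` reading's carriers are the floor-`c` carriers re-keyed along the floor-`c′`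
window (the form a COARSENING step `c ↦ c′` takes in dag-n19-w1's `core_of_core_classVal`). [bookkeeping] -/
theorem weightAK₁₃_window_of_le (h : ∀ K, c K ≤ c' K) (K : ℕ) (t : ℝ) (u : Σ K, SiteSeqKey F (K₀ + K)) :
    weightAK₁₃ θ hP K₀ g₀ os (fun _ x => windowKeySigma F c' x) K t u =
      letI : ∀ Kc, DecidableEq (SiteSeqKey F Kc) := fun _ => Classical.decEq _
      classVal (classSetK₁₃ θ K₀ g₀ (fun _ x => windowKeySigma F c x)) (fun _ x => windowKeySigma F c' x)
        (weightAK₁₃ θ hP K₀ g₀ os (fun _ x => windowKeySigma F c x)) K t u := by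
  have hmax : (fun K => max (c K) (c' K)) = c' := funext fun K => max_eq_right (h K)
  rw [← weightAK₁₃_window_max, hmax]

/-- Run B, likewise. [bookkeeping] -/
theorem weightBK₁₃_window_of_le (h : ∀ K, c K ≤ c' K) (K : ℕ) (t : ℝ) (u : Σ K, SiteSeqKey F (K₀ + K)) :
    weightBK₁₃ θ hP K₀ g₀ os (fun _ x => windowKeySigma F c' x) K t u =
      letI : ∀ Kc, DecidableEq (SiteSeqKey F Kc) := fun _ => Classical.decEq _
      classVal (classSetK₁₃ θ K₀ g₀ (fun _ x => windowKeySigma F c x)) (fun _ x => windowKeySigma F c' x)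
        (weightBK₁₃ θ hP K₀ g₀ os (fun _ x => windowKeySigma F c x)) K t u := by
  have hmax : (fun K => max (c K) (c' K)) = c' := funext fun K => max_eq_right (h K)
  rw [← weightBK₁₃_window_max, hmax]

/-- The class sets, likewise: for `c ≤ c′` the floor-`c′` class set is the floor-`c′`-window image of the floor-`c` class set. [bookkeeping] -/
theorem classSetK₁₃_window_of_le (h : ∀ K, c K ≤ c' K) (K : ℕ) :
    classSetK₁₃ θ K₀ g₀ (fun _ x => windowKeySigma F c' x) K =
      letI : ∀ Kc, DecidableEq (SiteSeqKey F Kc) := fun _ => Classical.decEq _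
      (classSetK₁₃ θ K₀ g₀ (fun _ x => windowKeySigma F c x) K).image (windowKeySigma F c') := by
  have hmax : (fun K => max (c K) (c' K)) = c' := funext fun K => max_eq_right (h K)
  rw [← classSetK₁₃_window_max, hmax]

end Tower

/-! ## §3 At the reading: the floor-`c′` reading's class set and weights from the floor-`c` reading's, per tuple -/

section Reading

variable (K₀ : ℕ) (c c' : FloorReading₁₃ N) (bd bd' : BadKeyReading₁₃ N K₀) (sh sh' : ShellSplit₁₃CoPH N K₀) (θ : Stage13HParams F N) (hP : θ.Provisos₁₃CoPH F N)
  (g₀ : ℕ → ℝ) (os : List (ULoop F))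

/-- ★ **THE WINDOW READINGS FORM A TOWER, AT THE READING**: if the floor reading `c′` dominates `c` at the tuple, the floor-`c′` reading's run-A class weight is node U5d's partial
sum of the floor-`c` reading's run-A class weight along `windowKeySigma (c′ …)` over the floor-`c` reading's class set (bad readings and shell splits play no role). [bookkeeping] -/
theorem crOfRecord₁₃KAt_window_A_of_le (h : ∀ K, c F θ hP g₀ os K ≤ c' F θ hP g₀ os K) (K : ℕ) (t : ℝ) (u : Σ K, SiteSeqKey F (K₀ + K)) :
    (crOfRecord₁₃KAt K₀ (windowKeyReading₁₃ K₀ c') bd' sh' F θ hP g₀ os).A K t u =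
      letI : ∀ Kc, DecidableEq (SiteSeqKey F Kc) := fun _ => Classical.decEq _
      classVal (crOfRecord₁₃KAt K₀ (windowKeyReading₁₃ K₀ c) bd sh F θ hP g₀ os).T (fun _ x => windowKeySigma F (c' F θ hP g₀ os) x)
        (crOfRecord₁₃KAt K₀ (windowKeyReading₁₃ K₀ c) bd sh F θ hP g₀ os).A K t u :=
  weightAK₁₃_window_of_le θ hP K₀ g₀ os _ _ h K t u

/-- Run B, likewise. [bookkeeping] -/
theorem crOfRecord₁₃KAt_window_B_of_le (h : ∀ K, c F θ hP g₀ os K ≤ c' F θ hP g₀ os K) (K : ℕ) (t : ℝ) (u : Σ K, SiteSeqKey F (K₀ + K)) :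
    (crOfRecord₁₃KAt K₀ (windowKeyReading₁₃ K₀ c') bd' sh' F θ hP g₀ os).B K t u =
      letI : ∀ Kc, DecidableEq (SiteSeqKey F Kc) := fun _ => Classical.decEq _
      classVal (crOfRecord₁₃KAt K₀ (windowKeyReading₁₃ K₀ c) bd sh F θ hP g₀ os).T (fun _ x => windowKeySigma F (c' F θ hP g₀ os) x)
        (crOfRecord₁₃KAt K₀ (windowKeyReading₁₃ K₀ c) bd sh F θ hP g₀ os).B K t u :=
  weightBK₁₃_window_of_le θ hP K₀ g₀ os _ _ h K t u

/-- The class sets at the reading, likewise. [bookkeeping] -/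
theorem crOfRecord₁₃KAt_window_T_of_le (h : ∀ K, c F θ hP g₀ os K ≤ c' F θ hP g₀ os K) (K : ℕ) :
    (crOfRecord₁₃KAt K₀ (windowKeyReading₁₃ K₀ c') bd' sh' F θ hP g₀ os).T K =
      letI : ∀ Kc, DecidableEq (SiteSeqKey F Kc) := fun _ => Classical.decEq _
      ((crOfRecord₁₃KAt K₀ (windowKeyReading₁₃ K₀ c) bd sh F θ hP g₀ os).T K).image (windowKeySigma F (c' F θ hP g₀ os)) :=
  classSetK₁₃_window_of_le θ K₀ g₀ _ _ h K

/-- Every window reading factors through the pinned record: its class weights are the record's `weightA₁₃` re-keyed along the window (`rfl`) — the form dag-n19-w1's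
`core_of_core_classVal` yields from a `Core` at `crOfRecord₁₃VAt`. [bookkeeping] -/
theorem crOfRecord₁₃KAt_window_A_eq_classVal_record (K : ℕ) (t : ℝ) (u : Σ K, SiteSeqKey F (K₀ + K)) :
    (crOfRecord₁₃KAt K₀ (windowKeyReading₁₃ K₀ c) bd sh F θ hP g₀ os).A K t u =
      letI : ∀ Kc, DecidableEq (SiteSeqKey F Kc) := fun _ => Classical.decEq _
      classVal (classSet₁₃ θ K₀ g₀) (fun _ x => windowKeySigma F (c F θ hP g₀ os) x) (weightA₁₃ θ hP K₀ g₀ os) K t u :=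
  rfl

end Reading

end YMDAG.UVSplit

end
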